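import Summits.CriticalPhenomena.CardyFormulaZ2.Theses.ModulusResponse
import Literature.Probability.RandomPlanarGeometry.ChordalCurveFamily

/-!
# Crux `SmirnovResponse` (stmt-CriticalPhenomena-6468), line `registered`: the boost group law and the
# registered stub `stub_stretchedRectangle` (stretched rectangles are rectangles)

Helper file (lead, `--supports stmt-CriticalPhenomena-6468`). The diagonal stretches
`S_t z = cosh t · z + i sinh t · z̄` of the route form a one-parameter group of plane homeomorphisms
(`stretch_comp`, `stretch_zero`, `continuous_stretch`); hence for every conformal rectangle `R` and
every `b` there is a conformal rectangle `R' = S_b R` with `S_a R' = S_{a+b} R` (carrier and arcs,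
`exists_stretched_rectangle`). Consequently every statement of the crux chain that quantifies over all
conformal rectangles `R` AND all pre-stretches `t` may be proved at a single pre-stretch `t₀` (the
skeleton's sorry-free glue `responseTight_of_anchor` / `clusterValue_of_anchor` does this with
`t₀ = -(log 3)/4`, Smirnov's point, where the `u = 0` model is the equilateral triangular lattice),
because the finite-mesh crossing events of `(R, t)` and of `(S_{t-t₀} R, t₀)` are literally the same
sets. The registered stub `stub_stretchedRectangle` is `exists_stretched_rectangle` with the skeleton's
verbatim signature.
-/

noncomputable section

namespace Summit.CriticalPhenomena.CardyFormulaZ2.Theorems.SmirnovResponse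

open Filter Topology Set MeasureTheory
open Literature.Probability.Percolation Literature.Probability.LatticeModels
  Literature.Probability.RandomPlanarGeometry

/-- **Boost group law** of the diagonal stretches: `S_a ∘ S_b = S_{a+b}`
(`cosh`/`sinh` addition formulas; `S_t` is the matrix `[[cosh t, sinh t], [sinh t, cosh t]]`). [folklore] -/
theorem stretch_comp (S : ℝ → ℂ → ℂ)
    (hS : ∀ t z, S t z = (Real.cosh t : ℂ) * z + Complex.I * (Real.sinh t : ℂ) * (starRingEnd ℂ) z)
    (a b : ℝ) (z : ℂ) : S a (S b z) = S (a + b) z := by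
  rw [hS, hS, hS, Real.cosh_add, Real.sinh_add]
  simp only [map_add, map_mul, Complex.conj_ofReal, Complex.conj_I, Complex.conj_conj]
  push_cast
  ring_nf
  rw [Complex.I_sq]
  ring

/-- `S_0` is the identity. [folklore] -/
theorem stretch_zero (S : ℝ → ℂ → ℂ)
    (hS : ∀ t z, S t z = (Real.cosh t : ℂ) * z + Complex.I * (Real.sinh t : ℂ) * (starRingEnd ℂ) z)
    (z : ℂ) : S 0 z = z := by
  rw [hS]; simp

/-- Each stretch `S_t` is continuous (it is real-linear). [folklore] -/
theorem continuous_stretch (S : ℝ → ℂ → ℂ)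
    (hS : ∀ t z, S t z = (Real.cosh t : ℂ) * z + Complex.I * (Real.sinh t : ℂ) * (starRingEnd ℂ) z)
    (t : ℝ) : Continuous (S t) := by
  have : S t = fun z => (Real.cosh t : ℂ) * z + Complex.I * (Real.sinh t : ℂ) * (starRingEnd ℂ) z :=
    funext (hS t)
  rw [this]; fun_prop

/-- **Stretched rectangles are rectangles**: for every conformal rectangle `R` and every `b` there is a
conformal rectangle `R'` (namely `S_b R`, `MarkedDomain.map` along the homeomorphism `S_b` with inverse
`S_{-b}`) whose stretched carriers and arcs are those of `R` with the stretch parameter translated: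
`S_a R' = S_{a+b} R`. [folklore] -/
theorem exists_stretched_rectangle (S : ℝ → ℂ → ℂ)
    (hS : ∀ t z, S t z = (Real.cosh t : ℂ) * z + Complex.I * (Real.sinh t : ℂ) * (starRingEnd ℂ) z)
    (R : ConformalRectangle) (b : ℝ) :
    ∃ R' : ConformalRectangle, ∀ a : ℝ, S a '' R'.carrier = S (a + b) '' R.carrier ∧
      ∀ i, S a '' R'.arc i = S (a + b) '' R.arc i := by
  let Th : ℂ ≃ₜ ℂ :=
    { toFun := S b
      invFun := S (-b)
      left_inv := fun z => by
        show S (-b) (S b z) = z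
        rw [stretch_comp S hS, neg_add_cancel, stretch_zero S hS]
      right_inv := fun z => by
        show S b (S (-b) z) = z
        rw [stretch_comp S hS, add_neg_cancel, stretch_zero S hS]
      continuous_toFun := continuous_stretch S hS b
      continuous_invFun := continuous_stretch S hS (-b) }
  have hTh : (Th : ℂ → ℂ) = S b := rfl
  refine ⟨R.map Th, fun a => ⟨?_, fun i => ?_⟩⟩
  · rw [MarkedDomain.carrier_map, hTh, image_image]
    exact image_congr fun z _ => stretch_comp S hS a b z
  · rw [MarkedDomain.arc_map, hTh, image_image]
    exact image_congr fun z _ => stretch_comp S hS a b z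

end Summit.CriticalPhenomena.CardyFormulaZ2.Theorems.SmirnovResponse

/-! ### The registered stub -/

namespace Summit.CriticalPhenomena.CardyFormulaZ2.Theorems

open Summit.CriticalPhenomena.CardyFormulaZ2.Theorems.SmirnovResponse

/-- **stub `stub_stretchedRectangle`** of the lead's skeleton for crux `SmirnovResponse`
(stmt-CriticalPhenomena-6468, line `registered`): stretched rectangles are rectangles — for the pinned
stretches `S` (a one-parameter group of plane homeomorphisms), every conformal rectangle `R` and every
`b` there is a conformal rectangle `R'` (= `S_b R`) with `S_a R' = S_{a+b} R` for every `a`, on the carrier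
and on every boundary arc. This is the bookkeeping that reduces every statement of the crux chain
quantified over all `(R, t)` to the single pre-stretch `t₀ = -(log 3)/4` (Smirnov's point). [folklore] -/
theorem stub_stretchedRectangle :
    ∀ (S : ℝ → ℂ → ℂ), (∀ t z, S t z = (Real.cosh t : ℂ) * z + Complex.I * (Real.sinh t : ℂ) * (starRingEnd ℂ) z) → ∀ (R : Literature.Probability.RandomPlanarGeometry.ConformalRectangle) (b : ℝ), ∃ R' : Literature.Probability.RandomPlanarGeometry.ConformalRectangle, ∀ a : ℝ, S a '' R'.carrier = S (a + b) '' R.carrier ∧ ∀ i, S a '' R'.arc i = S (a + b) '' R.arc i :=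
  fun S hS R b => exists_stretched_rectangle S hS R b

end Summit.CriticalPhenomena.CardyFormulaZ2.Theorems

end
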